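import Summits.BirchSwinnertonDyer.BirchSwinnertonDyer.Theorems.EisensteinDepletionAtTwoFamily81517IsogenySelmerBoundA

/-!
**PART C (§2b): the dead `S'`-classes with `3 ∥ d` (modulo `9`, `m ≡ 2 (3)`) and with `5 ∥ d` (modulo `25`, `m ≡ ±2 (5)`).** (one kernel unit `Family81517IsogenySelmerBound{A,B,C,D}`, checked as a single file rc 0; split for the 400-line lint.)

# Route EisensteinDepletionAtTwo — door `T-r3₂`: the WHOLE odd family has `rank ≤ 3`, and `rank = 3 ⇒ corank Sel_{2^∞} = 3`,
UNCONDITIONALLY (parametric complete `2`-isogeny descent in the kernel; planner p2 GEN 39, landed by lead star-p1 GEN 14)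

For every admissible member `(j, n)` of the door family (`m = 8j + 3`, `q = m + 64 n²`, `r = m + 289 n²` prime,
`60 ∣ n`) put `E = E_{−17q, 16qr} : y² = x(x − q)(x − 16 r)·…` (the tree's `⟨0, −17q, 0, 16qr, 0⟩`, carried to
`Family81517.curve j n` by `(u,r,s,t) = (2,0,1,0)`, `variableChange_family81517`) and `E' = E_{34q, 225mq}`.
Because `60 ∣ n` gives `q ≡ r ≡ m (mod 3600)`, every local computation at `2`, `3`, `5` is a function of
`m mod 16 ∈ {3, 11}`, `m mod 9`, `m mod 25` only, and is settled by `decide` over `ZMod 16 / 9 / 25` UNIFORMLY IN THE MEMBER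
(kit census j322002/j322023: the kill table is well defined on residues). Results (all sorry-free, standard axioms):

* `selmerGroup_subset` : `S^{(φ̂)}(E'/ℚ) = S(−17q, 16qr) ⊆ {1, q, r, qr}` (negatives die over `ℝ`, the even classes
  `2·{1,q,r,qr}` die `2`-adically: no solutions modulo `16`), so `dim₂ S^{(φ̂)} ≤ 2`;
* `selmerGroup'_subset_three` (`m ≡ 2 (mod 3)`): `S^{(φ)}(E/ℚ) = S(34q, 225mq) ⊆ {1, mq, −q, −m, 5, 5mq, −5q, −5m}`;
  `selmerGroup'_subset_five` (`m ≡ ±2 (mod 5)`): `S(34q, 225mq) ⊆ {1, mq, −q, −m, −3, −3mq, 3q, 3m}` — the classes with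
  `3 ∥ d` die modulo `9` when `m ≡ 2 (3)`, those with `5 ∥ d` die modulo `25` when `m ≡ ±2 (5)`, and the classes
  `d ≡ 3 (mod 4)` die modulo `16`; so `dim₂ S^{(φ)} ≤ 3` whenever `m ≡ 2 (3)` or `m ≡ ±2 (5)`;
* the root-number-odd half `OddSign` is exactly «`q ≡ 2 (3)` and `q ≡ ±1 (5)`» or «`q ≡ 1 (3)` and `q ≡ ±2 (5)`», and
  `q ≡ m (mod 15)`, so on the odd half `dim₂ S + dim₂ S' ≤ 5` and **`rank E(ℚ) ≤ 3`**
  (`twoIsogeny_mordellWeilRank_add_two_le_holds`; with the tree's `two_le_mordellWeilRank_family81517`: `rank ∈ {2, 3}`);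
* if `rank E(ℚ) = 3` the descent is sharp: `Ш(E/ℚ)[2] = 0`, `corank_{ℤ₂} Ш[2^∞] = 0`, **`corank Sel_{2^∞}(E) = 3`**, and
  `(dim₂ S, dim₂ S') = (2, 3)` exactly (`forall_mem_sha_two_smul_eq_zero_of_selmerRank_add_le`,
  `selmerCorank_eq_mordellWeilRank_add_holds`), transported to `Family81517.curve j n` (`selmerCorank_eq_of_variableChange`).

Door reading (`SelmerCorankEqOrderEqThreeOnOddFamily`, conjunct (ii) first half «`corank Sel_{2^∞} = 3`»): on the odd
family it is EQUIVALENT to «`rank = 3`, or `rank = 2` with `corank Ш[2^∞] = 1`»; the fifteen rank-`3` members of the kit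
census (j321923) are exactly the sharp ones. Nothing here proves BSD, the analytic conjunct, or moves S0; Barrier B1 honest.
-/

set_option linter.dupNamespace false
set_option linter.unusedTactic false
set_option autoImplicit false

namespace Summit.BirchSwinnertonDyer.BirchSwinnertonDyer.Theorems.Family81517IsogenySelmerBound

open Literature.NumberTheory.EllipticCurves
open Summit.BirchSwinnertonDyer.Rank2
open _root_.WeierstrassCurve

variable {m q r : ℕ} {n : ℤ}

/-- `3·1 ∉ S(34q, 225mq)`: no solutions modulo `9`. [cite: SilvermanAEC2009, Example X.4.10 (the congruence method)] -/
theorem nSp9_p3_1 (hm : m.Prime) (hq : q.Prime) (hn : 60 ∣ n) (hq_eq : (q : ℤ) = m + 64 * n ^ 2) (h3 : m % 3 = 2) :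
    ((3) * 1 : ℤ) ∉ twoIsogenySelmerGroup (34 * q) (225 * m * q) := by
  haveI : Fact (Nat.Prime 3) := ⟨Nat.prime_three⟩
  refine not_mem_of_residue (b'_ne_zero hm hq) (show (225 * m * q : ℤ) = ((3) * 1 : ℤ) * ((75) * ((m : ℤ) * q) : ℤ) by push_cast; ring) 3 2 9 (by norm_num)
    fun z t => ?_
  have hqN := natCast_q (m := m) 9 (by norm_num) hn hq_eq
  exact ne_and_ne_of_eq (kSp9_p3_0 (m : ZMod 9) (m_mod9 h3) z t)
    (by push_cast; (try rw [hqN]); (try ring)) (by push_cast; (try rw [hqN]); (try ring))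
/-- `3·m ∉ S(34q, 225mq)`: no solutions modulo `9`. [cite: SilvermanAEC2009, Example X.4.10 (the congruence method)] -/
theorem nSp9_p3_m (hm : m.Prime) (hq : q.Prime) (hn : 60 ∣ n) (hq_eq : (q : ℤ) = m + 64 * n ^ 2) (h3 : m % 3 = 2) :
    ((3) * (m : ℤ) : ℤ) ∉ twoIsogenySelmerGroup (34 * q) (225 * m * q) := by
  haveI : Fact (Nat.Prime 3) := ⟨Nat.prime_three⟩
  refine not_mem_of_residue (b'_ne_zero hm hq) (show (225 * m * q : ℤ) = ((3) * (m : ℤ) : ℤ) * ((75) * (q : ℤ) : ℤ) by push_cast; ring) 3 2 9 (by norm_num)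
    fun z t => ?_
  have hqN := natCast_q (m := m) 9 (by norm_num) hn hq_eq
  exact ne_and_ne_of_eq (kSp9_p3_1 (m : ZMod 9) (m_mod9 h3) z t)
    (by push_cast; (try rw [hqN]); (try ring)) (by push_cast; (try rw [hqN]); (try ring))
/-- `3·q ∉ S(34q, 225mq)`: no solutions modulo `9`. [cite: SilvermanAEC2009, Example X.4.10 (the congruence method)] -/
theorem nSp9_p3_q (hm : m.Prime) (hq : q.Prime) (hn : 60 ∣ n) (hq_eq : (q : ℤ) = m + 64 * n ^ 2) (h3 : m % 3 = 2) :
    ((3) * (q : ℤ) : ℤ) ∉ twoIsogenySelmerGroup (34 * q) (225 * m * q) := by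
  haveI : Fact (Nat.Prime 3) := ⟨Nat.prime_three⟩
  refine not_mem_of_residue (b'_ne_zero hm hq) (show (225 * m * q : ℤ) = ((3) * (q : ℤ) : ℤ) * ((75) * (m : ℤ) : ℤ) by push_cast; ring) 3 2 9 (by norm_num)
    fun z t => ?_
  have hqN := natCast_q (m := m) 9 (by norm_num) hn hq_eq
  exact ne_and_ne_of_eq (kSp9_p3_1 (m : ZMod 9) (m_mod9 h3) z t)
    (by push_cast; (try rw [hqN]); (try ring)) (by push_cast; (try rw [hqN]); (try ring))
/-- `3·mq ∉ S(34q, 225mq)`: no solutions modulo `9`. [cite: SilvermanAEC2009, Example X.4.10 (the congruence method)] -/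
theorem nSp9_p3_mq (hm : m.Prime) (hq : q.Prime) (hn : 60 ∣ n) (hq_eq : (q : ℤ) = m + 64 * n ^ 2) (h3 : m % 3 = 2) :
    ((3) * ((m : ℤ) * q) : ℤ) ∉ twoIsogenySelmerGroup (34 * q) (225 * m * q) := by
  haveI : Fact (Nat.Prime 3) := ⟨Nat.prime_three⟩
  refine not_mem_of_residue (b'_ne_zero hm hq) (show (225 * m * q : ℤ) = ((3) * ((m : ℤ) * q) : ℤ) * ((75) * 1 : ℤ) by push_cast; ring) 3 2 9 (by norm_num)
    fun z t => ?_
  have hqN := natCast_q (m := m) 9 (by norm_num) hn hq_eq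
  exact ne_and_ne_of_eq (kSp9_p3_2 (m : ZMod 9) (m_mod9 h3) z t)
    (by push_cast; (try rw [hqN]); (try ring)) (by push_cast; (try rw [hqN]); (try ring))
/-- `-3·1 ∉ S(34q, 225mq)`: no solutions modulo `9`. [cite: SilvermanAEC2009, Example X.4.10 (the congruence method)] -/
theorem nSp9_n3_1 (hm : m.Prime) (hq : q.Prime) (hn : 60 ∣ n) (hq_eq : (q : ℤ) = m + 64 * n ^ 2) (h3 : m % 3 = 2) :
    ((-3) * 1 : ℤ) ∉ twoIsogenySelmerGroup (34 * q) (225 * m * q) := by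
  haveI : Fact (Nat.Prime 3) := ⟨Nat.prime_three⟩
  refine not_mem_of_residue (b'_ne_zero hm hq) (show (225 * m * q : ℤ) = ((-3) * 1 : ℤ) * ((-75) * ((m : ℤ) * q) : ℤ) by push_cast; ring) 3 2 9 (by norm_num)
    fun z t => ?_
  have hqN := natCast_q (m := m) 9 (by norm_num) hn hq_eq
  exact ne_and_ne_of_eq (kSp9_n3_0 (m : ZMod 9) (m_mod9 h3) z t)
    (by push_cast; (try rw [hqN]); (try ring)) (by push_cast; (try rw [hqN]); (try ring))
/-- `-3·m ∉ S(34q, 225mq)`: no solutions modulo `9`. [cite: SilvermanAEC2009, Example X.4.10 (the congruence method)] -/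
theorem nSp9_n3_m (hm : m.Prime) (hq : q.Prime) (hn : 60 ∣ n) (hq_eq : (q : ℤ) = m + 64 * n ^ 2) (h3 : m % 3 = 2) :
    ((-3) * (m : ℤ) : ℤ) ∉ twoIsogenySelmerGroup (34 * q) (225 * m * q) := by
  haveI : Fact (Nat.Prime 3) := ⟨Nat.prime_three⟩
  refine not_mem_of_residue (b'_ne_zero hm hq) (show (225 * m * q : ℤ) = ((-3) * (m : ℤ) : ℤ) * ((-75) * (q : ℤ) : ℤ) by push_cast; ring) 3 2 9 (by norm_num)
    fun z t => ?_
  have hqN := natCast_q (m := m) 9 (by norm_num) hn hq_eq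
  exact ne_and_ne_of_eq (kSp9_n3_1 (m : ZMod 9) (m_mod9 h3) z t)
    (by push_cast; (try rw [hqN]); (try ring)) (by push_cast; (try rw [hqN]); (try ring))
/-- `-3·q ∉ S(34q, 225mq)`: no solutions modulo `9`. [cite: SilvermanAEC2009, Example X.4.10 (the congruence method)] -/
theorem nSp9_n3_q (hm : m.Prime) (hq : q.Prime) (hn : 60 ∣ n) (hq_eq : (q : ℤ) = m + 64 * n ^ 2) (h3 : m % 3 = 2) :
    ((-3) * (q : ℤ) : ℤ) ∉ twoIsogenySelmerGroup (34 * q) (225 * m * q) := by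
  haveI : Fact (Nat.Prime 3) := ⟨Nat.prime_three⟩
  refine not_mem_of_residue (b'_ne_zero hm hq) (show (225 * m * q : ℤ) = ((-3) * (q : ℤ) : ℤ) * ((-75) * (m : ℤ) : ℤ) by push_cast; ring) 3 2 9 (by norm_num)
    fun z t => ?_
  have hqN := natCast_q (m := m) 9 (by norm_num) hn hq_eq
  exact ne_and_ne_of_eq (kSp9_n3_1 (m : ZMod 9) (m_mod9 h3) z t)
    (by push_cast; (try rw [hqN]); (try ring)) (by push_cast; (try rw [hqN]); (try ring))
/-- `-3·mq ∉ S(34q, 225mq)`: no solutions modulo `9`. [cite: SilvermanAEC2009, Example X.4.10 (the congruence method)] -/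
theorem nSp9_n3_mq (hm : m.Prime) (hq : q.Prime) (hn : 60 ∣ n) (hq_eq : (q : ℤ) = m + 64 * n ^ 2) (h3 : m % 3 = 2) :
    ((-3) * ((m : ℤ) * q) : ℤ) ∉ twoIsogenySelmerGroup (34 * q) (225 * m * q) := by
  haveI : Fact (Nat.Prime 3) := ⟨Nat.prime_three⟩
  refine not_mem_of_residue (b'_ne_zero hm hq) (show (225 * m * q : ℤ) = ((-3) * ((m : ℤ) * q) : ℤ) * ((-75) * 1 : ℤ) by push_cast; ring) 3 2 9 (by norm_num)
    fun z t => ?_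
  have hqN := natCast_q (m := m) 9 (by norm_num) hn hq_eq
  exact ne_and_ne_of_eq (kSp9_n3_2 (m : ZMod 9) (m_mod9 h3) z t)
    (by push_cast; (try rw [hqN]); (try ring)) (by push_cast; (try rw [hqN]); (try ring))
/-- `15·1 ∉ S(34q, 225mq)`: no solutions modulo `9`. [cite: SilvermanAEC2009, Example X.4.10 (the congruence method)] -/
theorem nSp9_p15_1 (hm : m.Prime) (hq : q.Prime) (hn : 60 ∣ n) (hq_eq : (q : ℤ) = m + 64 * n ^ 2) (h3 : m % 3 = 2) :
    ((15) * 1 : ℤ) ∉ twoIsogenySelmerGroup (34 * q) (225 * m * q) := by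
  haveI : Fact (Nat.Prime 3) := ⟨Nat.prime_three⟩
  refine not_mem_of_residue (b'_ne_zero hm hq) (show (225 * m * q : ℤ) = ((15) * 1 : ℤ) * ((15) * ((m : ℤ) * q) : ℤ) by push_cast; ring) 3 2 9 (by norm_num)
    fun z t => ?_
  have hqN := natCast_q (m := m) 9 (by norm_num) hn hq_eq
  exact ne_and_ne_of_eq (kSp9_p15_0 (m : ZMod 9) (m_mod9 h3) z t)
    (by push_cast; (try rw [hqN]); (try ring)) (by push_cast; (try rw [hqN]); (try ring))
/-- `15·m ∉ S(34q, 225mq)`: no solutions modulo `9`. [cite: SilvermanAEC2009, Example X.4.10 (the congruence method)] -/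
theorem nSp9_p15_m (hm : m.Prime) (hq : q.Prime) (hn : 60 ∣ n) (hq_eq : (q : ℤ) = m + 64 * n ^ 2) (h3 : m % 3 = 2) :
    ((15) * (m : ℤ) : ℤ) ∉ twoIsogenySelmerGroup (34 * q) (225 * m * q) := by
  haveI : Fact (Nat.Prime 3) := ⟨Nat.prime_three⟩
  refine not_mem_of_residue (b'_ne_zero hm hq) (show (225 * m * q : ℤ) = ((15) * (m : ℤ) : ℤ) * ((15) * (q : ℤ) : ℤ) by push_cast; ring) 3 2 9 (by norm_num)
    fun z t => ?_
  have hqN := natCast_q (m := m) 9 (by norm_num) hn hq_eq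
  exact ne_and_ne_of_eq (kSp9_p15_1 (m : ZMod 9) (m_mod9 h3) z t)
    (by push_cast; (try rw [hqN]); (try ring)) (by push_cast; (try rw [hqN]); (try ring))
/-- `15·q ∉ S(34q, 225mq)`: no solutions modulo `9`. [cite: SilvermanAEC2009, Example X.4.10 (the congruence method)] -/
theorem nSp9_p15_q (hm : m.Prime) (hq : q.Prime) (hn : 60 ∣ n) (hq_eq : (q : ℤ) = m + 64 * n ^ 2) (h3 : m % 3 = 2) :
    ((15) * (q : ℤ) : ℤ) ∉ twoIsogenySelmerGroup (34 * q) (225 * m * q) := by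
  haveI : Fact (Nat.Prime 3) := ⟨Nat.prime_three⟩
  refine not_mem_of_residue (b'_ne_zero hm hq) (show (225 * m * q : ℤ) = ((15) * (q : ℤ) : ℤ) * ((15) * (m : ℤ) : ℤ) by push_cast; ring) 3 2 9 (by norm_num)
    fun z t => ?_
  have hqN := natCast_q (m := m) 9 (by norm_num) hn hq_eq
  exact ne_and_ne_of_eq (kSp9_p15_1 (m : ZMod 9) (m_mod9 h3) z t)
    (by push_cast; (try rw [hqN]); (try ring)) (by push_cast; (try rw [hqN]); (try ring))
/-- `15·mq ∉ S(34q, 225mq)`: no solutions modulo `9`. [cite: SilvermanAEC2009, Example X.4.10 (the congruence method)] -/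
theorem nSp9_p15_mq (hm : m.Prime) (hq : q.Prime) (hn : 60 ∣ n) (hq_eq : (q : ℤ) = m + 64 * n ^ 2) (h3 : m % 3 = 2) :
    ((15) * ((m : ℤ) * q) : ℤ) ∉ twoIsogenySelmerGroup (34 * q) (225 * m * q) := by
  haveI : Fact (Nat.Prime 3) := ⟨Nat.prime_three⟩
  refine not_mem_of_residue (b'_ne_zero hm hq) (show (225 * m * q : ℤ) = ((15) * ((m : ℤ) * q) : ℤ) * ((15) * 1 : ℤ) by push_cast; ring) 3 2 9 (by norm_num)
    fun z t => ?_
  have hqN := natCast_q (m := m) 9 (by norm_num) hn hq_eq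
  exact ne_and_ne_of_eq (kSp9_p15_2 (m : ZMod 9) (m_mod9 h3) z t)
    (by push_cast; (try rw [hqN]); (try ring)) (by push_cast; (try rw [hqN]); (try ring))
/-- `-15·1 ∉ S(34q, 225mq)`: no solutions modulo `9`. [cite: SilvermanAEC2009, Example X.4.10 (the congruence method)] -/
theorem nSp9_n15_1 (hm : m.Prime) (hq : q.Prime) (hn : 60 ∣ n) (hq_eq : (q : ℤ) = m + 64 * n ^ 2) (h3 : m % 3 = 2) :
    ((-15) * 1 : ℤ) ∉ twoIsogenySelmerGroup (34 * q) (225 * m * q) := by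
  haveI : Fact (Nat.Prime 3) := ⟨Nat.prime_three⟩
  refine not_mem_of_residue (b'_ne_zero hm hq) (show (225 * m * q : ℤ) = ((-15) * 1 : ℤ) * ((-15) * ((m : ℤ) * q) : ℤ) by push_cast; ring) 3 2 9 (by norm_num)
    fun z t => ?_
  have hqN := natCast_q (m := m) 9 (by norm_num) hn hq_eq
  exact ne_and_ne_of_eq (kSp9_n15_0 (m : ZMod 9) (m_mod9 h3) z t)
    (by push_cast; (try rw [hqN]); (try ring)) (by push_cast; (try rw [hqN]); (try ring))
/-- `-15·m ∉ S(34q, 225mq)`: no solutions modulo `9`. [cite: SilvermanAEC2009, Example X.4.10 (the congruence method)] -/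
theorem nSp9_n15_m (hm : m.Prime) (hq : q.Prime) (hn : 60 ∣ n) (hq_eq : (q : ℤ) = m + 64 * n ^ 2) (h3 : m % 3 = 2) :
    ((-15) * (m : ℤ) : ℤ) ∉ twoIsogenySelmerGroup (34 * q) (225 * m * q) := by
  haveI : Fact (Nat.Prime 3) := ⟨Nat.prime_three⟩
  refine not_mem_of_residue (b'_ne_zero hm hq) (show (225 * m * q : ℤ) = ((-15) * (m : ℤ) : ℤ) * ((-15) * (q : ℤ) : ℤ) by push_cast; ring) 3 2 9 (by norm_num)
    fun z t => ?_
  have hqN := natCast_q (m := m) 9 (by norm_num) hn hq_eq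
  exact ne_and_ne_of_eq (kSp9_n15_1 (m : ZMod 9) (m_mod9 h3) z t)
    (by push_cast; (try rw [hqN]); (try ring)) (by push_cast; (try rw [hqN]); (try ring))
/-- `-15·q ∉ S(34q, 225mq)`: no solutions modulo `9`. [cite: SilvermanAEC2009, Example X.4.10 (the congruence method)] -/
theorem nSp9_n15_q (hm : m.Prime) (hq : q.Prime) (hn : 60 ∣ n) (hq_eq : (q : ℤ) = m + 64 * n ^ 2) (h3 : m % 3 = 2) :
    ((-15) * (q : ℤ) : ℤ) ∉ twoIsogenySelmerGroup (34 * q) (225 * m * q) := by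
  haveI : Fact (Nat.Prime 3) := ⟨Nat.prime_three⟩
  refine not_mem_of_residue (b'_ne_zero hm hq) (show (225 * m * q : ℤ) = ((-15) * (q : ℤ) : ℤ) * ((-15) * (m : ℤ) : ℤ) by push_cast; ring) 3 2 9 (by norm_num)
    fun z t => ?_
  have hqN := natCast_q (m := m) 9 (by norm_num) hn hq_eq
  exact ne_and_ne_of_eq (kSp9_n15_1 (m : ZMod 9) (m_mod9 h3) z t)
    (by push_cast; (try rw [hqN]); (try ring)) (by push_cast; (try rw [hqN]); (try ring))
/-- `-15·mq ∉ S(34q, 225mq)`: no solutions modulo `9`. [cite: SilvermanAEC2009, Example X.4.10 (the congruence method)] -/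
theorem nSp9_n15_mq (hm : m.Prime) (hq : q.Prime) (hn : 60 ∣ n) (hq_eq : (q : ℤ) = m + 64 * n ^ 2) (h3 : m % 3 = 2) :
    ((-15) * ((m : ℤ) * q) : ℤ) ∉ twoIsogenySelmerGroup (34 * q) (225 * m * q) := by
  haveI : Fact (Nat.Prime 3) := ⟨Nat.prime_three⟩
  refine not_mem_of_residue (b'_ne_zero hm hq) (show (225 * m * q : ℤ) = ((-15) * ((m : ℤ) * q) : ℤ) * ((-15) * 1 : ℤ) by push_cast; ring) 3 2 9 (by norm_num)
    fun z t => ?_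
  have hqN := natCast_q (m := m) 9 (by norm_num) hn hq_eq
  exact ne_and_ne_of_eq (kSp9_n15_2 (m : ZMod 9) (m_mod9 h3) z t)
    (by push_cast; (try rw [hqN]); (try ring)) (by push_cast; (try rw [hqN]); (try ring))
/-- `5·1 ∉ S(34q, 225mq)`: no solutions modulo `25`. [cite: SilvermanAEC2009, Example X.4.10 (the congruence method)] -/
theorem nSp25_p5_1 (hm : m.Prime) (hq : q.Prime) (hn : 60 ∣ n) (hq_eq : (q : ℤ) = m + 64 * n ^ 2) (h5 : m % 5 = 2 ∨ m % 5 = 3) :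
    ((5) * 1 : ℤ) ∉ twoIsogenySelmerGroup (34 * q) (225 * m * q) := by
  haveI : Fact (Nat.Prime 5) := ⟨Nat.prime_five⟩
  refine not_mem_of_residue (b'_ne_zero hm hq) (show (225 * m * q : ℤ) = ((5) * 1 : ℤ) * ((45) * ((m : ℤ) * q) : ℤ) by push_cast; ring) 5 2 25 (by norm_num)
    fun z t => ?_
  have hqN := natCast_q (m := m) 25 (by norm_num) hn hq_eq
  exact ne_and_ne_of_eq (kSp25_p5_0 (m : ZMod 25) (m_mod25 h5) z t)
    (by push_cast; (try rw [hqN]); (try ring)) (by push_cast; (try rw [hqN]); (try ring))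
/-- `5·m ∉ S(34q, 225mq)`: no solutions modulo `25`. [cite: SilvermanAEC2009, Example X.4.10 (the congruence method)] -/
theorem nSp25_p5_m (hm : m.Prime) (hq : q.Prime) (hn : 60 ∣ n) (hq_eq : (q : ℤ) = m + 64 * n ^ 2) (h5 : m % 5 = 2 ∨ m % 5 = 3) :
    ((5) * (m : ℤ) : ℤ) ∉ twoIsogenySelmerGroup (34 * q) (225 * m * q) := by
  haveI : Fact (Nat.Prime 5) := ⟨Nat.prime_five⟩
  refine not_mem_of_residue (b'_ne_zero hm hq) (show (225 * m * q : ℤ) = ((5) * (m : ℤ) : ℤ) * ((45) * (q : ℤ) : ℤ) by push_cast; ring) 5 2 25 (by norm_num)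
    fun z t => ?_
  have hqN := natCast_q (m := m) 25 (by norm_num) hn hq_eq
  exact ne_and_ne_of_eq (kSp25_p5_1 (m : ZMod 25) (m_mod25 h5) z t)
    (by push_cast; (try rw [hqN]); (try ring)) (by push_cast; (try rw [hqN]); (try ring))
/-- `5·q ∉ S(34q, 225mq)`: no solutions modulo `25`. [cite: SilvermanAEC2009, Example X.4.10 (the congruence method)] -/
theorem nSp25_p5_q (hm : m.Prime) (hq : q.Prime) (hn : 60 ∣ n) (hq_eq : (q : ℤ) = m + 64 * n ^ 2) (h5 : m % 5 = 2 ∨ m % 5 = 3) :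
    ((5) * (q : ℤ) : ℤ) ∉ twoIsogenySelmerGroup (34 * q) (225 * m * q) := by
  haveI : Fact (Nat.Prime 5) := ⟨Nat.prime_five⟩
  refine not_mem_of_residue (b'_ne_zero hm hq) (show (225 * m * q : ℤ) = ((5) * (q : ℤ) : ℤ) * ((45) * (m : ℤ) : ℤ) by push_cast; ring) 5 2 25 (by norm_num)
    fun z t => ?_
  have hqN := natCast_q (m := m) 25 (by norm_num) hn hq_eq
  exact ne_and_ne_of_eq (kSp25_p5_1 (m : ZMod 25) (m_mod25 h5) z t)
    (by push_cast; (try rw [hqN]); (try ring)) (by push_cast; (try rw [hqN]); (try ring))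
/-- `5·mq ∉ S(34q, 225mq)`: no solutions modulo `25`. [cite: SilvermanAEC2009, Example X.4.10 (the congruence method)] -/
theorem nSp25_p5_mq (hm : m.Prime) (hq : q.Prime) (hn : 60 ∣ n) (hq_eq : (q : ℤ) = m + 64 * n ^ 2) (h5 : m % 5 = 2 ∨ m % 5 = 3) :
    ((5) * ((m : ℤ) * q) : ℤ) ∉ twoIsogenySelmerGroup (34 * q) (225 * m * q) := by
  haveI : Fact (Nat.Prime 5) := ⟨Nat.prime_five⟩
  refine not_mem_of_residue (b'_ne_zero hm hq) (show (225 * m * q : ℤ) = ((5) * ((m : ℤ) * q) : ℤ) * ((45) * 1 : ℤ) by push_cast; ring) 5 2 25 (by norm_num)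
    fun z t => ?_
  have hqN := natCast_q (m := m) 25 (by norm_num) hn hq_eq
  exact ne_and_ne_of_eq (kSp25_p5_2 (m : ZMod 25) (m_mod25 h5) z t)
    (by push_cast; (try rw [hqN]); (try ring)) (by push_cast; (try rw [hqN]); (try ring))
/-- `-5·1 ∉ S(34q, 225mq)`: no solutions modulo `25`. [cite: SilvermanAEC2009, Example X.4.10 (the congruence method)] -/
theorem nSp25_n5_1 (hm : m.Prime) (hq : q.Prime) (hn : 60 ∣ n) (hq_eq : (q : ℤ) = m + 64 * n ^ 2) (h5 : m % 5 = 2 ∨ m % 5 = 3) :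
    ((-5) * 1 : ℤ) ∉ twoIsogenySelmerGroup (34 * q) (225 * m * q) := by
  haveI : Fact (Nat.Prime 5) := ⟨Nat.prime_five⟩
  refine not_mem_of_residue (b'_ne_zero hm hq) (show (225 * m * q : ℤ) = ((-5) * 1 : ℤ) * ((-45) * ((m : ℤ) * q) : ℤ) by push_cast; ring) 5 2 25 (by norm_num)
    fun z t => ?_
  have hqN := natCast_q (m := m) 25 (by norm_num) hn hq_eq
  exact ne_and_ne_of_eq (kSp25_n5_0 (m : ZMod 25) (m_mod25 h5) z t)
    (by push_cast; (try rw [hqN]); (try ring)) (by push_cast; (try rw [hqN]); (try ring))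
/-- `-5·m ∉ S(34q, 225mq)`: no solutions modulo `25`. [cite: SilvermanAEC2009, Example X.4.10 (the congruence method)] -/
theorem nSp25_n5_m (hm : m.Prime) (hq : q.Prime) (hn : 60 ∣ n) (hq_eq : (q : ℤ) = m + 64 * n ^ 2) (h5 : m % 5 = 2 ∨ m % 5 = 3) :
    ((-5) * (m : ℤ) : ℤ) ∉ twoIsogenySelmerGroup (34 * q) (225 * m * q) := by
  haveI : Fact (Nat.Prime 5) := ⟨Nat.prime_five⟩
  refine not_mem_of_residue (b'_ne_zero hm hq) (show (225 * m * q : ℤ) = ((-5) * (m : ℤ) : ℤ) * ((-45) * (q : ℤ) : ℤ) by push_cast; ring) 5 2 25 (by norm_num)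
    fun z t => ?_
  have hqN := natCast_q (m := m) 25 (by norm_num) hn hq_eq
  exact ne_and_ne_of_eq (kSp25_n5_1 (m : ZMod 25) (m_mod25 h5) z t)
    (by push_cast; (try rw [hqN]); (try ring)) (by push_cast; (try rw [hqN]); (try ring))
/-- `-5·q ∉ S(34q, 225mq)`: no solutions modulo `25`. [cite: SilvermanAEC2009, Example X.4.10 (the congruence method)] -/
theorem nSp25_n5_q (hm : m.Prime) (hq : q.Prime) (hn : 60 ∣ n) (hq_eq : (q : ℤ) = m + 64 * n ^ 2) (h5 : m % 5 = 2 ∨ m % 5 = 3) :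
    ((-5) * (q : ℤ) : ℤ) ∉ twoIsogenySelmerGroup (34 * q) (225 * m * q) := by
  haveI : Fact (Nat.Prime 5) := ⟨Nat.prime_five⟩
  refine not_mem_of_residue (b'_ne_zero hm hq) (show (225 * m * q : ℤ) = ((-5) * (q : ℤ) : ℤ) * ((-45) * (m : ℤ) : ℤ) by push_cast; ring) 5 2 25 (by norm_num)
    fun z t => ?_
  have hqN := natCast_q (m := m) 25 (by norm_num) hn hq_eq
  exact ne_and_ne_of_eq (kSp25_n5_1 (m : ZMod 25) (m_mod25 h5) z t)
    (by push_cast; (try rw [hqN]); (try ring)) (by push_cast; (try rw [hqN]); (try ring))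
/-- `-5·mq ∉ S(34q, 225mq)`: no solutions modulo `25`. [cite: SilvermanAEC2009, Example X.4.10 (the congruence method)] -/
theorem nSp25_n5_mq (hm : m.Prime) (hq : q.Prime) (hn : 60 ∣ n) (hq_eq : (q : ℤ) = m + 64 * n ^ 2) (h5 : m % 5 = 2 ∨ m % 5 = 3) :
    ((-5) * ((m : ℤ) * q) : ℤ) ∉ twoIsogenySelmerGroup (34 * q) (225 * m * q) := by
  haveI : Fact (Nat.Prime 5) := ⟨Nat.prime_five⟩
  refine not_mem_of_residue (b'_ne_zero hm hq) (show (225 * m * q : ℤ) = ((-5) * ((m : ℤ) * q) : ℤ) * ((-45) * 1 : ℤ) by push_cast; ring) 5 2 25 (by norm_num)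
    fun z t => ?_
  have hqN := natCast_q (m := m) 25 (by norm_num) hn hq_eq
  exact ne_and_ne_of_eq (kSp25_n5_2 (m : ZMod 25) (m_mod25 h5) z t)
    (by push_cast; (try rw [hqN]); (try ring)) (by push_cast; (try rw [hqN]); (try ring))
/-- `15·1 ∉ S(34q, 225mq)`: no solutions modulo `25`. [cite: SilvermanAEC2009, Example X.4.10 (the congruence method)] -/
theorem nSp25_p15_1 (hm : m.Prime) (hq : q.Prime) (hn : 60 ∣ n) (hq_eq : (q : ℤ) = m + 64 * n ^ 2) (h5 : m % 5 = 2 ∨ m % 5 = 3) :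
    ((15) * 1 : ℤ) ∉ twoIsogenySelmerGroup (34 * q) (225 * m * q) := by
  haveI : Fact (Nat.Prime 5) := ⟨Nat.prime_five⟩
  refine not_mem_of_residue (b'_ne_zero hm hq) (show (225 * m * q : ℤ) = ((15) * 1 : ℤ) * ((15) * ((m : ℤ) * q) : ℤ) by push_cast; ring) 5 2 25 (by norm_num)
    fun z t => ?_
  have hqN := natCast_q (m := m) 25 (by norm_num) hn hq_eq
  exact ne_and_ne_of_eq (kSp25_p15_0 (m : ZMod 25) (m_mod25 h5) z t)
    (by push_cast; (try rw [hqN]); (try ring)) (by push_cast; (try rw [hqN]); (try ring))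
/-- `15·m ∉ S(34q, 225mq)`: no solutions modulo `25`. [cite: SilvermanAEC2009, Example X.4.10 (the congruence method)] -/
theorem nSp25_p15_m (hm : m.Prime) (hq : q.Prime) (hn : 60 ∣ n) (hq_eq : (q : ℤ) = m + 64 * n ^ 2) (h5 : m % 5 = 2 ∨ m % 5 = 3) :
    ((15) * (m : ℤ) : ℤ) ∉ twoIsogenySelmerGroup (34 * q) (225 * m * q) := by
  haveI : Fact (Nat.Prime 5) := ⟨Nat.prime_five⟩
  refine not_mem_of_residue (b'_ne_zero hm hq) (show (225 * m * q : ℤ) = ((15) * (m : ℤ) : ℤ) * ((15) * (q : ℤ) : ℤ) by push_cast; ring) 5 2 25 (by norm_num)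
    fun z t => ?_
  have hqN := natCast_q (m := m) 25 (by norm_num) hn hq_eq
  exact ne_and_ne_of_eq (kSp25_p15_1 (m : ZMod 25) (m_mod25 h5) z t)
    (by push_cast; (try rw [hqN]); (try ring)) (by push_cast; (try rw [hqN]); (try ring))
/-- `15·q ∉ S(34q, 225mq)`: no solutions modulo `25`. [cite: SilvermanAEC2009, Example X.4.10 (the congruence method)] -/
theorem nSp25_p15_q (hm : m.Prime) (hq : q.Prime) (hn : 60 ∣ n) (hq_eq : (q : ℤ) = m + 64 * n ^ 2) (h5 : m % 5 = 2 ∨ m % 5 = 3) :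
    ((15) * (q : ℤ) : ℤ) ∉ twoIsogenySelmerGroup (34 * q) (225 * m * q) := by
  haveI : Fact (Nat.Prime 5) := ⟨Nat.prime_five⟩
  refine not_mem_of_residue (b'_ne_zero hm hq) (show (225 * m * q : ℤ) = ((15) * (q : ℤ) : ℤ) * ((15) * (m : ℤ) : ℤ) by push_cast; ring) 5 2 25 (by norm_num)
    fun z t => ?_
  have hqN := natCast_q (m := m) 25 (by norm_num) hn hq_eq
  exact ne_and_ne_of_eq (kSp25_p15_1 (m : ZMod 25) (m_mod25 h5) z t)
    (by push_cast; (try rw [hqN]); (try ring)) (by push_cast; (try rw [hqN]); (try ring))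
/-- `15·mq ∉ S(34q, 225mq)`: no solutions modulo `25`. [cite: SilvermanAEC2009, Example X.4.10 (the congruence method)] -/
theorem nSp25_p15_mq (hm : m.Prime) (hq : q.Prime) (hn : 60 ∣ n) (hq_eq : (q : ℤ) = m + 64 * n ^ 2) (h5 : m % 5 = 2 ∨ m % 5 = 3) :
    ((15) * ((m : ℤ) * q) : ℤ) ∉ twoIsogenySelmerGroup (34 * q) (225 * m * q) := by
  haveI : Fact (Nat.Prime 5) := ⟨Nat.prime_five⟩
  refine not_mem_of_residue (b'_ne_zero hm hq) (show (225 * m * q : ℤ) = ((15) * ((m : ℤ) * q) : ℤ) * ((15) * 1 : ℤ) by push_cast; ring) 5 2 25 (by norm_num)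
    fun z t => ?_
  have hqN := natCast_q (m := m) 25 (by norm_num) hn hq_eq
  exact ne_and_ne_of_eq (kSp25_p15_2 (m : ZMod 25) (m_mod25 h5) z t)
    (by push_cast; (try rw [hqN]); (try ring)) (by push_cast; (try rw [hqN]); (try ring))
/-- `-15·1 ∉ S(34q, 225mq)`: no solutions modulo `25`. [cite: SilvermanAEC2009, Example X.4.10 (the congruence method)] -/
theorem nSp25_n15_1 (hm : m.Prime) (hq : q.Prime) (hn : 60 ∣ n) (hq_eq : (q : ℤ) = m + 64 * n ^ 2) (h5 : m % 5 = 2 ∨ m % 5 = 3) :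
    ((-15) * 1 : ℤ) ∉ twoIsogenySelmerGroup (34 * q) (225 * m * q) := by
  haveI : Fact (Nat.Prime 5) := ⟨Nat.prime_five⟩
  refine not_mem_of_residue (b'_ne_zero hm hq) (show (225 * m * q : ℤ) = ((-15) * 1 : ℤ) * ((-15) * ((m : ℤ) * q) : ℤ) by push_cast; ring) 5 2 25 (by norm_num)
    fun z t => ?_
  have hqN := natCast_q (m := m) 25 (by norm_num) hn hq_eq
  exact ne_and_ne_of_eq (kSp25_n15_0 (m : ZMod 25) (m_mod25 h5) z t)
    (by push_cast; (try rw [hqN]); (try ring)) (by push_cast; (try rw [hqN]); (try ring))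
/-- `-15·m ∉ S(34q, 225mq)`: no solutions modulo `25`. [cite: SilvermanAEC2009, Example X.4.10 (the congruence method)] -/
theorem nSp25_n15_m (hm : m.Prime) (hq : q.Prime) (hn : 60 ∣ n) (hq_eq : (q : ℤ) = m + 64 * n ^ 2) (h5 : m % 5 = 2 ∨ m % 5 = 3) :
    ((-15) * (m : ℤ) : ℤ) ∉ twoIsogenySelmerGroup (34 * q) (225 * m * q) := by
  haveI : Fact (Nat.Prime 5) := ⟨Nat.prime_five⟩
  refine not_mem_of_residue (b'_ne_zero hm hq) (show (225 * m * q : ℤ) = ((-15) * (m : ℤ) : ℤ) * ((-15) * (q : ℤ) : ℤ) by push_cast; ring) 5 2 25 (by norm_num)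
    fun z t => ?_
  have hqN := natCast_q (m := m) 25 (by norm_num) hn hq_eq
  exact ne_and_ne_of_eq (kSp25_n15_1 (m : ZMod 25) (m_mod25 h5) z t)
    (by push_cast; (try rw [hqN]); (try ring)) (by push_cast; (try rw [hqN]); (try ring))
/-- `-15·q ∉ S(34q, 225mq)`: no solutions modulo `25`. [cite: SilvermanAEC2009, Example X.4.10 (the congruence method)] -/
theorem nSp25_n15_q (hm : m.Prime) (hq : q.Prime) (hn : 60 ∣ n) (hq_eq : (q : ℤ) = m + 64 * n ^ 2) (h5 : m % 5 = 2 ∨ m % 5 = 3) :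
    ((-15) * (q : ℤ) : ℤ) ∉ twoIsogenySelmerGroup (34 * q) (225 * m * q) := by
  haveI : Fact (Nat.Prime 5) := ⟨Nat.prime_five⟩
  refine not_mem_of_residue (b'_ne_zero hm hq) (show (225 * m * q : ℤ) = ((-15) * (q : ℤ) : ℤ) * ((-15) * (m : ℤ) : ℤ) by push_cast; ring) 5 2 25 (by norm_num)
    fun z t => ?_
  have hqN := natCast_q (m := m) 25 (by norm_num) hn hq_eq
  exact ne_and_ne_of_eq (kSp25_n15_1 (m : ZMod 25) (m_mod25 h5) z t)
    (by push_cast; (try rw [hqN]); (try ring)) (by push_cast; (try rw [hqN]); (try ring))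
/-- `-15·mq ∉ S(34q, 225mq)`: no solutions modulo `25`. [cite: SilvermanAEC2009, Example X.4.10 (the congruence method)] -/
theorem nSp25_n15_mq (hm : m.Prime) (hq : q.Prime) (hn : 60 ∣ n) (hq_eq : (q : ℤ) = m + 64 * n ^ 2) (h5 : m % 5 = 2 ∨ m % 5 = 3) :
    ((-15) * ((m : ℤ) * q) : ℤ) ∉ twoIsogenySelmerGroup (34 * q) (225 * m * q) := by
  haveI : Fact (Nat.Prime 5) := ⟨Nat.prime_five⟩
  refine not_mem_of_residue (b'_ne_zero hm hq) (show (225 * m * q : ℤ) = ((-15) * ((m : ℤ) * q) : ℤ) * ((-15) * 1 : ℤ) by push_cast; ring) 5 2 25 (by norm_num)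
    fun z t => ?_
  have hqN := natCast_q (m := m) 25 (by norm_num) hn hq_eq
  exact ne_and_ne_of_eq (kSp25_n15_2 (m : ZMod 25) (m_mod25 h5) z t)
    (by push_cast; (try rw [hqN]); (try ring)) (by push_cast; (try rw [hqN]); (try ring))


end Summit.BirchSwinnertonDyer.BirchSwinnertonDyer.Theorems.Family81517IsogenySelmerBound
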